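import Literature.NumberTheory.EllipticCurves.SchollBettiRealisation
import Literature.NumberTheory.EllipticCurves.KugaSatoVariety
import Literature.AlgebraicGeometry.Motives.VarietiesProperProofs
import Literature.AlgebraicGeometry.Motives.AlgPointsProperProofs
import Literature.AlgebraicGeometry.Motives.BaseChangeProofs
import Literature.AlgebraicGeometry.Motives.ProjectiveOfGeneratingSections
import Literature.NumberTheory.Transcendental.AnalytificationChartsProofs
import Literature.NumberTheory.Transcendental.AnalytificationSeparatedProofs
import Literature.AlgebraicTopology.SingularHomology.CohomologyFiniteness
import Mathlib.AlgebraicGeometry.Morphisms.Etale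
import Mathlib.RingTheory.Etale.Field
import Mathlib.NumberTheory.Cyclotomic.PrimitiveRoots
import Mathlib.Analysis.InnerProductSpace.PiL2
import Mathlib.Topology.Algebra.Module.FiniteDimension
import HarnessLib

/-!
# Scholl's Betti realisation: naturality of `F_∞` and the odd-weight case

Layer `Literature/NumberTheory/EllipticCurves` (grouping namespace `…ModularForms`), companion to
`SchollBettiRealisation` (the hypothesis structure `SchollBettiRealisation f`; the existence of the
datum for every newform `f ∈ S_k(Γ₀(N))`, `k ≥ 2` — Scholl 1990, Thm. 1.2.4, Deninger–Scholl 1991,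
Thm. 5.2 — is NOT a named fact of the tree: D-0026 review-split of 2026-08-15, see the module
docstring of `SchollBettiRealisation`; consumers take `(D : SchollBettiRealisation f)` as a
parameter). This file records proved pieces of Scholl's construction of that datum which are
available now:

* `complexConjPoints_comp_mapContinuous`, `bettiCohomology_map_comp_frobInfty`,
  `bettiCohomology_map_frobInfty` — **`F_∞` is natural in the `ℚ`-scheme**: for a `ℚ`-morphism
  `φ : W → W'`, complex conjugation of complex points commutes with `φ(ℂ)` (the action of
  `Aut(ℂ/ℚ)` on points is by precomposition, `Motives.AlgPoints.map_smul`), hence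
  `φ* ∘ F_∞ = F_∞ ∘ φ*` on `Hⁱ(-(ℂ); ℚ)` (Deninger–Scholl 1991, (2.2): the infinite Frobenius is an
  endomorphism of the Betti realisation of varieties defined over `ℝ`). This is the mechanism
  behind the fields `proj_comp_frobInfty` / `coeffAct_comp_frobInfty` of
  `SchollBettiRealisation` ("`Π_f` and the Hecke correspondences are defined over `ℚ`, hence
  commute with `F_∞`", Deninger–Scholl 5.3–5.4), for the pull-back half of the action of a
  correspondence.
* `nonempty_schollBettiRealisation_of_odd` — existence is vacuous in odd weight: `-1 ∈ Γ₀(N)`,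
  so `S_k(Γ₀(N)) = 0` for odd `k` (the tree's `eq_zero_of_odd_weight_gamma0`, from Mathlib's
  `ModularForm.eq_zero_of_neg_one_mem`), while a newform has `a₁ = 1`.
* **Step S1 of Scholl's construction, modulo the named fact `nonempty_kugaSatoVariety`** (the
  fields `W`, `smooth`, `projective`, `finite` of `SchollBettiRealisation f`). Scholl's
  `W = X̄̄_nʷ` is a smooth projective `ℚ`-scheme which is not geometrically connected; the tree's
  `KugaSatoVariety K m n` is one geometric component, defined over a field `K ∋ ζ_n`
  (Deninger–Scholl 1991, §4.1: `M_n ⊗ ℂ` is `φ(n)` copies of `Γ(n)∖ℍ`). Regarding it over `ℚ`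
  through `Spec K → Spec ℚ` (`Over.map`) gives Scholl's scheme up to the choice of component:
  `smoothOfRelativeDimension_map_specMap` (a finite separable `Spec K → Spec k` is étale, so
  relative dimensions are unchanged), `isProjectiveOver_map_specMap` (restriction of scalars
  along a finite extension preserves projectivity: `Z ↪ ℙⁿ_K ≅ ℙⁿ_k ×_k K → ℙⁿ_k` is an affine
  `k`-morphism of a proper `k`-scheme, Görtz–Wedhorn I, Thm. 13.84 (2) with Cor. 13.72, the
  tree's `isProjectiveOver_of_isAffineHom`), `finite_bettiCohomology_of_isProper`
  (`Hⁱ(X(ℂ); ℚ)` is finite-dimensional for `X` smooth and proper over any subfield `k ⊆ ℂ`: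
  `X(ℂ)` is a compact Hausdorff `2n`-manifold, as in
  `HodgeTheory.finite_singularCohomology_rat_complexPoints`), assembled in
  `KugaSatoVariety.smoothOfRelativeDimension_overRat`, `…isProjectiveOver_overRat`,
  `…finite_bettiCohomology_overRat` and `exists_kugaSato_overRat` (level `n = 3N`,
  `K = ℚ(ζ_n)`, `w = k - 2` factors, relative dimension `k - 1`).

## Status of the existence of the datum (why no instance is constructed here)

Scholl's construction (Scholl 1990, §1, Thm. 1.2.4; Deninger–Scholl 1991, 5.1–5.4 and 5.2
Remark (2), read) takes `W = X̄̄_nʷ`, the desingularised `w`-fold fibre power of the universal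
elliptic curve over the compactified modular curve of full level `n` (`w = k - 2`, `N ∣ n`,
`n ≥ 3`), regarded over `ℚ`. In the tree this scheme exists only through the unproved named fact
`Literature.NumberTheory.EllipticCurves.nonempty_kugaSatoVariety` (`KugaSatoVariety`), and the
further inputs — Hecke correspondences on `W`, Scholl's algebraic projector `Π_f`
(Deninger–Scholl Thm. 5.2, 5.3 (i)–(ii)), the Eichler–Shimura–Deligne identification of
`Π_ε H^{k-1}(W(ℂ), ℚ)` with parabolic cohomology and its Hodge type `(k-1,0)+(0,k-1)`
(5.2 Remark (2)), the Hodge structure and a polarisation on `H^{k-1}(W(ℂ), ℚ)` (the tree's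
`HodgeTheory.nonempty_hodgeModel` is itself a named fact), and Shokurov's cycles carrying the
modular symbols `{0,∞} ⊗ zʲ` — have no counterpart in Mathlib or in the tree yet. For this reason
the existence `∀ f newform, Nonempty (SchollBettiRealisation f)` is not a named fact (an earlier
`nonempty_schollBettiRealisation` was merged back at the D-0026 review-split of 2026-08-15): it is
to be supplied by this construction, not asserted.

## References

* [Scholl1990] A. J. Scholl, Motives for modular forms, Invent. Math. 100 (1990), §1, Thm. 1.2.4.
* [DeningerScholl1991] C. Deninger, A. J. Scholl, The Beilinson conjectures, in: L-functions and
  Arithmetic (Durham 1989), LMS LNS 153, CUP 1991, (2.2), 5.1–5.4 (read, pp. of §5).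
* [GortzWedhorn2020] U. Görtz, T. Wedhorn, Algebraic Geometry I: Schemes, 2nd ed. (2020),
  Thm. 13.84 (2) (p. 516), Cor. 13.72 (p. 512).
* [HatcherAT2002] A. Hatcher, Algebraic Topology, CUP 2002, App. A Cor. A.8–A.9, §3.1 Cor. 3.3.
-/

noncomputable section

open CategoryTheory Limits AlgebraicGeometry

universe u

namespace Literature.NumberTheory.EllipticCurves.ModularForms

open Literature.AlgebraicGeometry.Motives Literature.AlgebraicTopology.SingularHomology

/-! ### `F_∞` commutes with pull-backs along `ℚ`-morphisms -/

section Naturality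

variable {W W' : SchemeOver ℚ}

/-- Complex conjugation of complex points commutes with the map on complex points induced by a
`ℚ`-morphism `φ : W → W'`: `c ∘ φ(ℂ) = φ(ℂ) ∘ c` (the action of `Aut(ℂ/ℚ)` on points is by
precomposition with `Spec` of the automorphism, `Motives.AlgPoints.map_smul`). [folklore] -/
theorem complexConjPoints_comp_mapContinuous (φ : W ⟶ W') :
    (complexConjPoints W').comp (AlgPoints.mapContinuous (L := ℂ) φ) =
      (AlgPoints.mapContinuous (L := ℂ) φ).comp (complexConjPoints W) := by
  ext P : 1
  simp [AlgPoints.map_smul]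

/-- **`F_∞` is natural**: for a `ℚ`-morphism `φ : W → W'`, pull-back in Betti cohomology commutes
with the infinite Frobenius, `φ* ∘ F_∞ = F_∞ ∘ φ*` on `Hⁱ(-(ℂ); ℚ)` (functoriality of singular
cohomology applied to `c ∘ φ(ℂ) = φ(ℂ) ∘ c`; Deninger–Scholl 1991, (2.2)).
[cite: DeningerScholl1991, (2.2)] -/
theorem bettiCohomology_map_comp_frobInfty (φ : W ⟶ W') (i : ℕ) :
    (bettiCohomology.map φ i).hom ∘ₗ frobInfty W' i =
      frobInfty W i ∘ₗ (bettiCohomology.map φ i).hom := by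
  have h : singularCohomology.map ℚ ℚ (complexConjPoints W') i ≫
        singularCohomology.map ℚ ℚ (AlgPoints.mapContinuous (L := ℂ) φ) i =
      singularCohomology.map ℚ ℚ (AlgPoints.mapContinuous (L := ℂ) φ) i ≫
        singularCohomology.map ℚ ℚ (complexConjPoints W) i := by
    rw [← singularCohomology.map_comp, ← singularCohomology.map_comp,
      complexConjPoints_comp_mapContinuous]
  have h' := congrArg ModuleCat.Hom.hom h
  rw [ModuleCat.hom_comp, ModuleCat.hom_comp] at h'
  exact h'

/-- Pointwise form of the naturality of `F_∞`: `φ* (F_∞ x) = F_∞ (φ* x)`.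
[cite: DeningerScholl1991, (2.2)] -/
theorem bettiCohomology_map_frobInfty (φ : W ⟶ W') (i : ℕ) (x : bettiCohomology W' i) :
    bettiCohomology.map φ i (frobInfty W' i x) = frobInfty W i (bettiCohomology.map φ i x) :=
  LinearMap.congr_fun (bettiCohomology_map_comp_frobInfty φ i) x

/-- An endomorphism of `Hⁱ(W(ℂ); ℚ)` induced by a `ℚ`-endomorphism `φ` of `W` commutes with `F_∞`
(the case `W' = W`; e.g. the automorphisms generating Scholl's group `Γ`, Deninger–Scholl 5.3 (i)).
[cite: DeningerScholl1991, (2.2) and 5.3 (i)] -/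
theorem bettiCohomology_map_comp_frobInfty_self (φ : W ⟶ W) (i : ℕ) :
    (bettiCohomology.map φ i).hom ∘ₗ frobInfty W i = frobInfty W i ∘ₗ (bettiCohomology.map φ i).hom :=
  bettiCohomology_map_comp_frobInfty φ i

end Naturality

/-! ### Odd weight -/

/-- **Odd weight is vacuous.** There is no newform of odd weight on `Γ₀(N)`: `-1 ∈ Γ₀(N)` forces
`S_k(Γ₀(N)) = 0` for odd `k` (`eq_zero_of_odd_weight_gamma0`), whereas a newform is normalised
(`a₁ = 1`). Hence `Nonempty (SchollBettiRealisation f)` holds trivially for such `f`, and the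
content of the existence of Scholl's datum is in even weight `k ≥ 2`. [folklore] -/
theorem nonempty_schollBettiRealisation_of_odd {N : ℕ} [NeZero N] {k : ℤ} (hk : Odd k)
    (f : CuspForm (CongruenceSubgroup.Gamma0 N) k) (hf : IsNewform0 f) :
    Nonempty (SchollBettiRealisation f) := by
  exfalso
  have h0 : f = 0 := eq_zero_of_odd_weight_gamma0 N hk f
  have h1 := hf.2.2
  rw [IsNormalized, h0] at h1
  simp [UpperHalfPlane.qExpansion_zero] at h1

/-! ### Finiteness of Betti cohomology for smooth proper schemes over a subfield of `ℂ` -/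

section Finite

variable {k : Type} [Field k] [Algebra k ℂ]

/-- **`Hⁱ(X(ℂ); ℚ)` is finite-dimensional for `X` smooth of relative dimension `n` and proper over
a subfield `k ⊆ ℂ`** (no irreducibility needed): `X(ℂ)` is a compact (`X` proper,
`Motives.compactSpace_algPoints_of_isProper_holds`) Hausdorff (`X` separated) topological
`2n`-manifold (holomorphic algebraic charts `X(ℂ) ⇀ ℂⁿ ≃ₜ ℝ²ⁿ`, Serre GAGA §2,
`Transcendental.exists_algebraicChart_holds`), so Hatcher's finiteness
(`finite_singularCohomology_of_compact_chartedSpace`) applies — the proof of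
`HodgeTheory.finite_singularCohomology_rat_complexPoints`, whose ingredients are all stated over
an arbitrary subfield of `ℂ`. [cite: HatcherAT2002, App. A Cor. A.9 and §3.1 Cor. 3.3]
[cite: SerreGAGA1956, §2 n°5 Prop. 2] -/
theorem finite_bettiCohomology_of_isProper (X : SchemeOver k) (n : ℕ)
    [SmoothOfRelativeDimension n X.hom] [IsProper X.hom] (i : ℕ) :
    Module.Finite ℚ (bettiCohomology X i) := by
  haveI : AlgebraicGeometry.Smooth X.hom := SmoothOfRelativeDimension.smooth n X.hom
  choose chart mem _ using fun P : ComplexPoints X ↦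
    Literature.NumberTheory.Transcendental.exists_algebraicChart_holds X n P
  let eC : (Fin n → ℂ) ≃ₜ EuclideanSpace ℝ (Fin (2 * n)) :=
    (ContinuousLinearEquiv.ofFinrankEq (𝕜 := ℝ) (by
      rw [Module.finrank_pi_fintype, finrank_euclideanSpace_fin]
      simp [Complex.finrank_real_complex, mul_comm])).toHomeomorph
  letI : ChartedSpace (EuclideanSpace ℝ (Fin (2 * n))) (ComplexPoints X) :=
    { atlas := Set.range fun P ↦ (chart P).transHomeomorph eC
      chartAt := fun P ↦ (chart P).transHomeomorph eC
      mem_chart_source := fun P ↦ by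
        rw [OpenPartialHomeomorph.transHomeomorph_source]; exact mem P
      chart_mem_atlas := fun P ↦ ⟨P, rfl⟩ }
  haveI : CompactSpace (ComplexPoints X) := compactSpace_algPoints_of_isProper_holds X ℂ
  haveI : T2Space (ComplexPoints X) := ComplexPoints.t2Space_of_isSeparated X
  exact finite_singularCohomology_of_compact_chartedSpace ℚ ℚ (d := 2 * n) i

/-- `Hⁱ(X(ℂ); ℚ)` is finite-dimensional for `X` smooth of relative dimension `n` and projective
over a subfield `k ⊆ ℂ` (projective ⇒ proper, Hartshorne II Thm. 4.9). This discharges the field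
`finite` of `SchollBettiRealisation f` for ANY candidate `W` satisfying the fields `smooth` and
`projective`. [cite: HatcherAT2002, App. A Cor. A.9 and §3.1 Cor. 3.3] -/
theorem finite_bettiCohomology_of_isProjectiveOver (X : SchemeOver k) (n : ℕ)
    [SmoothOfRelativeDimension n X.hom] (hX : IsProjectiveOver X) (i : ℕ) :
    Module.Finite ℚ (bettiCohomology X i) :=
  haveI := hX.isProper
  finite_bettiCohomology_of_isProper X n i

end Finite

/-! ### Restriction of scalars along a finite separable extension -/

section RestrictScalars

variable (k K : Type u) [Field k] [Field K] [Algebra k K]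

/-- `Spec K → Spec k` is étale for a finite separable extension `K/k` (Mathlib:
`Algebra.FormallyEtale.of_isSeparable`, finite ⇒ finitely presented over a field). [folklore] -/
theorem etale_specMap_algebraMap [Algebra.IsSeparable k K] [Module.Finite k K] :
    Etale (Spec.map (CommRingCat.ofHom (algebraMap k K))) := by
  rw [HasRingHomProperty.Spec_iff (P := @Etale), CommRingCat.hom_ofHom, RingHom.etale_algebraMap]
  haveI : Algebra.FormallyEtale k K := Algebra.FormallyEtale.of_isSeparable k K
  haveI : Algebra.FinitePresentation k K :=
    (Algebra.FinitePresentation.of_finiteType (R := k) (A := K)).mp inferInstance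
  exact {}

/-- `Spec K → Spec k` is finite for a finite extension `K/k`. [folklore] -/
theorem isFinite_specMap_algebraMap [Module.Finite k K] :
    IsFinite (Spec.map (CommRingCat.ofHom (algebraMap k K))) := by
  rw [IsFinite.SpecMap_iff, CommRingCat.hom_ofHom, RingHom.finite_algebraMap]
  infer_instance

variable {K}

set_option backward.isDefEq.respectTransparency false in
/-- Restriction of scalars along a finite separable extension preserves smoothness of relative
dimension `n`: `Spec K → Spec k` is étale, i.e. smooth of relative dimension `0`, and relative
dimensions add under composition (Mathlib `smoothOfRelativeDimension_comp`). [folklore] -/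
theorem smoothOfRelativeDimension_map_specMap [Algebra.IsSeparable k K] [Module.Finite k K]
    {n : ℕ} (Z : SchemeOver K) [SmoothOfRelativeDimension n Z.hom] :
    SmoothOfRelativeDimension n
      ((Over.map (Spec.map (CommRingCat.ofHom (algebraMap k K)))).obj Z).hom := by
  haveI := etale_specMap_algebraMap k K
  haveI h0 : SmoothOfRelativeDimension 0 (Spec.map (CommRingCat.ofHom (algebraMap k K))) :=
    inferInstance
  have h := @AlgebraicGeometry.smoothOfRelativeDimension_comp n 0 _ _ Z.hom _
    (Spec.map (CommRingCat.ofHom (algebraMap k K))) ‹_› h0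
  exact h

set_option backward.isDefEq.respectTransparency false in
/-- Restriction of scalars along a finite extension preserves properness (`Spec K → Spec k` is
finite, hence proper). [folklore] -/
theorem isProper_map_specMap [Module.Finite k K] (Z : SchemeOver K) [IsProper Z.hom] :
    IsProper ((Over.map (Spec.map (CommRingCat.ofHom (algebraMap k K)))).obj Z).hom := by
  haveI := isFinite_specMap_algebraMap k K
  haveI hs : IsProper (Spec.map (CommRingCat.ofHom (algebraMap k K))) := inferInstance
  exact MorphismProperty.comp_mem @IsProper Z.hom (Spec.map (CommRingCat.ofHom (algebraMap k K)))
    ‹_› hs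

set_option backward.isDefEq.respectTransparency false in
/-- **Restriction of scalars along a finite extension preserves projectivity.** If `Z ↪ ℙⁿ_K` is a
closed `K`-immersion and `K/k` is finite, then `Z`, regarded as a `k`-scheme through
`Spec K → Spec k`, is projective over `k`: it is proper over `k`, and
`Z ↪ ℙⁿ_K ≅ ℙⁿ_k ×_k K → ℙⁿ_k` is an affine `k`-morphism (a closed immersion followed by the base
change of the affine morphism `Spec K → Spec k`), so Görtz–Wedhorn I, Thm. 13.84 (2) with
Cor. 13.72 (the tree's `isProjectiveOver_of_isAffineHom`) applies.
[cite: GortzWedhorn2020, Thm. 13.84 (2) (p. 516) with Cor. 13.72 (p. 512)] -/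
theorem isProjectiveOver_map_specMap [Module.Finite k K] (Z : SchemeOver K)
    (hZ : IsProjectiveOver Z) :
    IsProjectiveOver ((Over.map (Spec.map (CommRingCat.ofHom (algebraMap k K)))).obj Z) := by
  obtain ⟨n, ι, hι⟩ := hZ
  haveI : IsProper Z.hom := IsProjectiveOver.isProper ⟨n, ι, hι⟩
  haveI : IsProper ((Over.map (Spec.map (CommRingCat.ofHom (algebraMap k K)))).obj Z).hom :=
    isProper_map_specMap k Z
  -- the comparison `ℙⁿ_K ≅ ℙⁿ_k ×_k K → ℙⁿ_k`
  let q : (projectiveSpace n K).left ⟶ (projectiveSpace n k).left :=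
    (projectiveSpaceBaseChangeIso k K n).hom.left ≫
      pullback.fst (projectiveSpace n k).hom (Spec.map (CommRingCat.ofHom (algebraMap k K)))
  have hq : q ≫ (projectiveSpace n k).hom =
      (projectiveSpace n K).hom ≫ Spec.map (CommRingCat.ofHom (algebraMap k K)) := by
    simp only [q, Category.assoc, pullback.condition]
    rw [← Over.w (projectiveSpaceBaseChangeIso k K n).hom, Category.assoc]
    rfl
  have h1 : IsIso (projectiveSpaceBaseChangeIso k K n).hom.left :=
    inferInstanceAs (IsIso ((Over.forget _).map (projectiveSpaceBaseChangeIso k K n).hom))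
  have h2 : IsAffineHom (pullback.fst (projectiveSpace n k).hom
      (Spec.map (CommRingCat.ofHom (algebraMap k K)))) :=
    MorphismProperty.pullback_fst _ _ inferInstance
  have hqa : IsAffineHom q := MorphismProperty.comp_mem _ _ _ inferInstance h2
  have hιq : IsAffineHom (ι.left ≫ q) := MorphismProperty.comp_mem _ _ _ inferInstance hqa
  have hw : (ι.left ≫ q) ≫ (projectiveSpace n k).hom =
      Z.hom ≫ Spec.map (CommRingCat.ofHom (algebraMap k K)) := by
    rw [Category.assoc, hq, ← Category.assoc, Over.w ι]
  let r : (Over.map (Spec.map (CommRingCat.ofHom (algebraMap k K)))).obj Z ⟶ projectiveSpace n k :=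
    Over.homMk (ι.left ≫ q) hw
  haveI : IsAffineHom r.left := hιq
  exact isProjectiveOver_of_isAffineHom r

end RestrictScalars

/-! ### S1 of the published proof: Scholl's Kuga–Sato variety regarded over `ℚ` -/

section KugaSato

open Literature.NumberTheory.EllipticCurves (KugaSatoVariety nonempty_kugaSatoVariety)

variable {K : Type} [Field K] [NumberField K] {m n : ℕ}

/-- The Kuga–Sato variety `W → Spec K → Spec ℚ` regarded as a `ℚ`-scheme is smooth of relative
dimension `m + 1` over `ℚ` (`K` a number field: `Spec K → Spec ℚ` is étale). This is how Scholl's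
`X̄̄_nʷ/ℚ` (Scholl 1990, §1; Deninger–Scholl 1991, 5.1: smooth projective over `ℚ`, not
geometrically connected) arises from the tree's component-wise `KugaSatoVariety K m n`,
`K ∋ ζ_n`. [cite: DeningerScholl1991, §4.1 and 5.1] -/
theorem _root_.Literature.NumberTheory.EllipticCurves.KugaSatoVariety.smoothOfRelativeDimension_overRat
    (V : KugaSatoVariety K m n) :
    SmoothOfRelativeDimension (m + 1)
      ((Over.map (Spec.map (CommRingCat.ofHom (algebraMap ℚ K)))).obj V.W).hom :=
  haveI := V.smoothOfRelativeDimension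
  smoothOfRelativeDimension_map_specMap ℚ V.W

/-- The Kuga–Sato variety regarded over `ℚ` is projective over `ℚ`.
[cite: DeningerScholl1991, 5.1] -/
theorem _root_.Literature.NumberTheory.EllipticCurves.KugaSatoVariety.isProjectiveOver_overRat
    (V : KugaSatoVariety K m n) :
    IsProjectiveOver ((Over.map (Spec.map (CommRingCat.ofHom (algebraMap ℚ K)))).obj V.W) :=
  isProjectiveOver_map_specMap ℚ V.W V.isProjectiveOver

/-- The Betti cohomology `Hⁱ(W(ℂ); ℚ)` of the Kuga–Sato variety regarded over `ℚ` is
finite-dimensional (`W(ℂ)` is a compact complex manifold). [folklore] -/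
theorem _root_.Literature.NumberTheory.EllipticCurves.KugaSatoVariety.finite_bettiCohomology_overRat
    (V : KugaSatoVariety K m n) (i : ℕ) :
    Module.Finite ℚ
      (bettiCohomology ((Over.map (Spec.map (CommRingCat.ofHom (algebraMap ℚ K)))).obj V.W) i) :=
  haveI := V.smoothOfRelativeDimension_overRat
  finite_bettiCohomology_of_isProjectiveOver _ (m + 1) V.isProjectiveOver_overRat i

/-- Weight bookkeeping: for `k ≥ 2`, `w + 1 = k - 1` with `w = k - 2` (as natural numbers).
[folklore] -/
theorem toNat_sub_two_add_one {k : ℤ} (hk : 2 ≤ k) : (k - 2).toNat + 1 = (k - 1).toNat := by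
  omega

/-- **Step S1 of Scholl's construction of the datum `SchollBettiRealisation f`, modulo the named
fact `nonempty_kugaSatoVariety`.** Given that fact, for every level `N ≥ 1` and weight `k ≥ 2` there
is a level `n` with `3 ≤ n`, `N ∣ n`, and a Kuga–Sato variety `V` of level `n` with `w = k - 2`
factors over the cyclotomic field `ℚ(ζ_n)`, whose total space regarded over `ℚ` — Scholl's
`X̄̄_nʷ` — inhabits the fields `W`, `smooth`, `projective`, `finite` of `SchollBettiRealisation f`
for any `f` of weight `k`: a smooth projective `ℚ`-scheme of relative dimension `k - 1` with
finite-dimensional `H^{k-1}(W(ℂ); ℚ)` (Scholl 1990, §1; Deninger–Scholl 1991, 4.1–4.2 and 5.1: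
"`n ≥ 3` an integer divisible by `N`"). The remaining fields (Hodge structure, `Π_f`, the
`K_f`-action, `ω_f`, periods) are steps S2–S5 and are not touched here.
[cite: Scholl1990, §1] [cite: DeningerScholl1991, 4.1–4.2 and 5.1] -/
theorem exists_kugaSato_overRat (hKS : nonempty_kugaSatoVariety.{0}) (N : ℕ) [NeZero N] {k : ℤ}
    (hk : 2 ≤ k) :
    ∃ (n : ℕ) (_ : NeZero n) (V : KugaSatoVariety (CyclotomicField n ℚ) (k - 2).toNat n),
      3 ≤ n ∧ N ∣ n ∧
      SmoothOfRelativeDimension (k - 1).toNat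
        ((Over.map (Spec.map (CommRingCat.ofHom
          (algebraMap ℚ (CyclotomicField n ℚ))))).obj V.W).hom ∧
      IsProjectiveOver
        ((Over.map (Spec.map (CommRingCat.ofHom
          (algebraMap ℚ (CyclotomicField n ℚ))))).obj V.W) ∧
      Module.Finite ℚ (bettiCohomology
        ((Over.map (Spec.map (CommRingCat.ofHom
          (algebraMap ℚ (CyclotomicField n ℚ))))).obj V.W) (k - 1).toNat) := by
  have hN : N ≠ 0 := NeZero.ne N
  haveI : NeZero (3 * N) := ⟨by omega⟩
  haveI : NeZero ((3 * N : ℕ) : ℚ) := ⟨by exact_mod_cast (show 3 * N ≠ 0 by omega)⟩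
  -- `ℚ(ζ_{3N})` contains a primitive `3N`-th root of unity (the instance is applied by hand: its
  -- `ℚ`-algebra structure on the splitting field is only definitionally the canonical one)
  obtain ⟨ζ, hζ⟩ := (CyclotomicField.isCyclotomicExtension (3 * N) ℚ).exists_isPrimitiveRoot
    (Set.mem_singleton (3 * N)) (NeZero.ne (3 * N))
  obtain ⟨V⟩ := hKS (CyclotomicField (3 * N) ℚ) (k - 2).toNat (3 * N) (by omega) ⟨ζ, hζ⟩
  refine ⟨3 * N, inferInstance, V, by omega, Dvd.intro_left 3 rfl, ?_, V.isProjectiveOver_overRat, ?_⟩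
  · rw [← toNat_sub_two_add_one hk]
    exact V.smoothOfRelativeDimension_overRat
  · rw [← toNat_sub_two_add_one hk]
    exact V.finite_bettiCohomology_overRat _

end KugaSato

end Literature.NumberTheory.EllipticCurves.ModularForms

end
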